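import Mathlib
import HarnessLib
import Summits.ResolutionOfSingularities.ResolutionOfSingularities.Theorems.WildQuotientsWildQuotientResolutionS1aCuspPoints
import Summits.ResolutionOfSingularities.ResolutionOfSingularities.Theorems.WildQuotientsWildQuotientResolutionS1aQhAwayDatum
import Summits.ResolutionOfSingularities.ResolutionOfSingularities.Theorems.WildQuotientsWildQuotientResolutionS1aQhSymAwayDatum

/-!
# S1a — R4c cusp, the per-point FILTRATION FACTS as one `Fin 2`-family (`Cusp.cusp_pointFacts`)

[OURS · L1 W4.5c · crux stmt-ResolutionOfSingularities-17941 `CyclicQuotientFourfolds`, line `s1a-logminvertex` v13 (`stub_reachLowerInFX`); R4c cusp,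
assembly step (b6) of `Lines/s1a_logminvertex-R4c-PROGRESS.md` §4] — NOT a statement of the manuscript; counted 0; AI-level work, weaker than expert review.

Companion of ✓`GameFrame.GModel.exists_cusp_pointCentre` (✓p795218): for the point datum `σᵢ` (`i : Fin 2`; rows `x₂ ↦ (x₂ + x₀, x₂)ᵢ`,
`x₃ ↦ x₃ + (x₂² − x₁³, T_Q)ᵢ`, weights `((9,2,3), (3,1,2))ᵢ`, shift `(6, 2)ᵢ`) on the localised node `L = k[x][1/hh]` the inputs of
✓`exists_moveAtlas_of_nodes` that in R4e came uniformly from `QhAway.qhl_*`: the tail lies in the weighted piece `sh`, `σ`-adaptedness `hσJ`, (H1)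
`aug σ_R ≤ (s^sh)`, and the residual memberships of `u₀′` and `t̂` — from ✓`QhSym.qsl_map_le`/`qsl_residual` at `O` (two moving generators) and from
✓`QhAway.qhl_map_le`/`qhl_augmentationIdeal_sigmaR_le`/`qhl_u'_zero_mem_residual`/`qhl_tail_mem_residual` at `Q`.
-/

set_option linter.dupNamespace false

noncomputable section

open Literature.AlgebraicGeometry.Resolution
open scoped LaurentPolynomial
open MvPolynomial
open Summit.ResolutionOfSingularities.ResolutionOfSingularities.Theorems.WildQuotientResolution.S1
open Summit.ResolutionOfSingularities.ResolutionOfSingularities.Theorems.WildQuotientResolution.S1.CoarseChart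
open Summit.ResolutionOfSingularities.ResolutionOfSingularities.Theorems.WildQuotientResolution.S1.NodeAway
open Summit.ResolutionOfSingularities.ResolutionOfSingularities.Theorems.WildQuotientResolution.S1.CentreAway
open Summit.ResolutionOfSingularities.ResolutionOfSingularities.Theorems.WildQuotientResolution.S1.GameFrame.GModel
open Summit.ResolutionOfSingularities.ResolutionOfSingularities.Theorems.WildQuotientResolution.S1.KillCert

namespace Summit.ResolutionOfSingularities.ResolutionOfSingularities.Theorems.WildQuotientResolution.S1.KillCert.Cusp

variable {k : Type} [Field k]

set_option maxHeartbeats 4000000 in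
/-- ★ **R4c: the per-point filtration facts of the cusp, both points as one `Fin 2`-family** — tail membership `ht`, `σ`-adaptedness `hσJ`, (H1)
`aug σ_R ≤ (s^{sh})`, and the residual memberships of `u₀′` and of `t̂ = t·T^{sh}` — for `i = 0` the point `O` (weights `(9,2,3)`, shift `6`,
✓`QhSym.qsl_*`), for `i = 1` the point `Q` (weights `(3,1,2)`, shift `2`, ✓`QhAway.qhl_*`). [OURS · L1 W4.5c · R4c (b6); NOT a statement of the manuscript] -/
theorem cusp_pointFacts {p : ℕ} (hp : 0 < p) (a c : k)
    (σ : (MvPolynomial (Fin 4) k) ≃+* (MvPolynomial (Fin 4) k)) (hC : ∀ a : k, σ (C a) = C a)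
    (h0 : σ (X 0) = X 0) (h1 : σ (X 1) = X 1 + X 0) (i : Fin 2)
    (h2 : σ (X 2) = (![X 2 + X 0, X 2] : Fin 2 → (MvPolynomial (Fin 4) k)) i)
    (h3 : σ (X 3) = X 3 + (![(X 2 ^ 2 - X 1 ^ 3 : MvPolynomial (Fin 4) k), (X 2 ^ 2 + 2 * X 1 * X 2 + C (2 * c) * X 2 + C (1 - 3 * a) * X 1 ^ 2 - X 1 ^ 3 : MvPolynomial (Fin 4) k)] : Fin 2 → (MvPolynomial (Fin 4) k)) i)
    (hh : (MvPolynomial (Fin 4) k)) (hσh : σ hh = hh) (hσp : ∀ x : (MvPolynomial (Fin 4) k), (⇑σ)^[p] x = x) :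
    ∃ (ht : algebraMap (MvPolynomial (Fin 4) k) (Localization.Away hh)
          ((![(X 2 ^ 2 - X 1 ^ 3 : MvPolynomial (Fin 4) k), (X 2 ^ 2 + 2 * X 1 * X 2 + C (2 * c) * X 2 + C (1 - 3 * a) * X 1 ^ 2 - X 1 ^ 3 : MvPolynomial (Fin 4) k)] : Fin 2 → (MvPolynomial (Fin 4) k)) i) ∈
        (weightedFiltration (fun l => algebraMap (MvPolynomial (Fin 4) k) (Localization.Away hh) (X ((![0, 1, 2] : Fin 3 → Fin 4) l)))
          ((![(![9, 2, 3] : Fin 3 → ℕ), (![3, 1, 2] : Fin 3 → ℕ)] : Fin 2 → (Fin 3 → ℕ)) i)).ideal ((![6, 2] : Fin 2 → ℕ) i))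
      (hσJ : ∀ n : ℕ, ((weightedFiltration (fun l => algebraMap (MvPolynomial (Fin 4) k) (Localization.Away hh) (X ((![0, 1, 2] : Fin 3 → Fin 4) l)))
          ((![(![9, 2, 3] : Fin 3 → ℕ), (![3, 1, 2] : Fin 3 → ℕ)] : Fin 2 → (Fin 3 → ℕ)) i)).ideal n).map
            ((sigmaAway σ hσh) : (Localization.Away hh) →+* (Localization.Away hh)) ≤
          (weightedFiltration (fun l => algebraMap (MvPolynomial (Fin 4) k) (Localization.Away hh) (X ((![0, 1, 2] : Fin 3 → Fin 4) l)))
            ((![(![9, 2, 3] : Fin 3 → ℕ), (![3, 1, 2] : Fin 3 → ℕ)] : Fin 2 → (Fin 3 → ℕ)) i)).ideal n),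
      augmentationIdeal (sigmaR (sigmaAway σ hσh) (fun l => algebraMap (MvPolynomial (Fin 4) k) (Localization.Away hh) (X ((![0, 1, 2] : Fin 3 → Fin 4) l)))
          ((![(![9, 2, 3] : Fin 3 → ℕ), (![3, 1, 2] : Fin 3 → ℕ)] : Fin 2 → (Fin 3 → ℕ)) i) hσJ hp (QhAway.qhl_iterate σ hh hσh hσp)) ≤
        Ideal.span {cobordantAlgebra.s (fun l => algebraMap (MvPolynomial (Fin 4) k) (Localization.Away hh) (X ((![0, 1, 2] : Fin 3 → Fin 4) l)))
          ((![(![9, 2, 3] : Fin 3 → ℕ), (![3, 1, 2] : Fin 3 → ℕ)] : Fin 2 → (Fin 3 → ℕ)) i) ^ ((![6, 2] : Fin 2 → ℕ) i)} ∧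
      cobordantAlgebra.u' (fun l => algebraMap (MvPolynomial (Fin 4) k) (Localization.Away hh) (X ((![0, 1, 2] : Fin 3 → Fin 4) l)))
          ((![(![9, 2, 3] : Fin 3 → ℕ), (![3, 1, 2] : Fin 3 → ℕ)] : Fin 2 → (Fin 3 → ℕ)) i) 0 ∈
        (augmentationIdeal (sigmaR (sigmaAway σ hσh) (fun l => algebraMap (MvPolynomial (Fin 4) k) (Localization.Away hh) (X ((![0, 1, 2] : Fin 3 → Fin 4) l)))
          ((![(![9, 2, 3] : Fin 3 → ℕ), (![3, 1, 2] : Fin 3 → ℕ)] : Fin 2 → (Fin 3 → ℕ)) i) hσJ hp (QhAway.qhl_iterate σ hh hσh hσp))).colon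
          (Ideal.span {cobordantAlgebra.s (fun l => algebraMap (MvPolynomial (Fin 4) k) (Localization.Away hh) (X ((![0, 1, 2] : Fin 3 → Fin 4) l)))
            ((![(![9, 2, 3] : Fin 3 → ℕ), (![3, 1, 2] : Fin 3 → ℕ)] : Fin 2 → (Fin 3 → ℕ)) i) ^ ((![6, 2] : Fin 2 → ℕ) i)}) ∧
      (⟨_, C_mul_T_mem_cobordantAlgebra _ _ ht⟩ : ↥(cobordantAlgebra (fun l => algebraMap (MvPolynomial (Fin 4) k) (Localization.Away hh) (X ((![0, 1, 2] : Fin 3 → Fin 4) l)))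
          ((![(![9, 2, 3] : Fin 3 → ℕ), (![3, 1, 2] : Fin 3 → ℕ)] : Fin 2 → (Fin 3 → ℕ)) i))) ∈
        (augmentationIdeal (sigmaR (sigmaAway σ hσh) (fun l => algebraMap (MvPolynomial (Fin 4) k) (Localization.Away hh) (X ((![0, 1, 2] : Fin 3 → Fin 4) l)))
          ((![(![9, 2, 3] : Fin 3 → ℕ), (![3, 1, 2] : Fin 3 → ℕ)] : Fin 2 → (Fin 3 → ℕ)) i) hσJ hp (QhAway.qhl_iterate σ hh hσh hσp))).colon
          (Ideal.span {cobordantAlgebra.s (fun l => algebraMap (MvPolynomial (Fin 4) k) (Localization.Away hh) (X ((![0, 1, 2] : Fin 3 → Fin 4) l)))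
            ((![(![9, 2, 3] : Fin 3 → ℕ), (![3, 1, 2] : Fin 3 → ℕ)] : Fin 2 → (Fin 3 → ℕ)) i) ^ ((![6, 2] : Fin 2 → ℕ) i)}) := by
  revert h2 h3
  refine Fin.cases ?_ (fun j => Fin.cases ?_ (fun l => l.elim0) j) i
  · -- the point `O`: weights `(9,2,3)`, shift `6`, both tail generators moving
    intro h2 h3
    have hw1 : (![9, 2, 3] : Fin 3 → ℕ) 1 + 6 ≤ (![9, 2, 3] : Fin 3 → ℕ) 0 := by decide
    have hw2 : (![9, 2, 3] : Fin 3 → ℕ) 0 = (![9, 2, 3] : Fin 3 → ℕ) 2 + 6 := by decide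
    have h2' : σ (X 2) = X 2 + X 0 := h2
    have h3' : σ (X 3) = X 3 + (X 2 ^ 2 - X 1 ^ 3 : MvPolynomial (Fin 4) k) := h3
    have ht := QhAway.qhl_tail_mem (X 2 ^ 2 - X 1 ^ 3 : MvPolynomial (Fin 4) k) (![9, 2, 3] : Fin 3 → ℕ) 6 Cusp.cuspTail_mem hh
    have hσJ := QhSym.qsl_map_le σ hC h0 h1 h2' (X 2 ^ 2 - X 1 ^ 3 : MvPolynomial (Fin 4) k) h3' (![9, 2, 3] : Fin 3 → ℕ) 6 hw1 hw2 Cusp.cuspTail_mem hh hσh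
    exact ⟨ht, hσJ, QhSym.qsl_residual σ hC h0 h1 h2' (X 2 ^ 2 - X 1 ^ 3 : MvPolynomial (Fin 4) k) h3' (![9, 2, 3] : Fin 3 → ℕ) 6 hw1 hw2 Cusp.cuspTail_mem hh hσh
      hp hσp hσJ⟩
  · -- the tangency point `Q`: weights `(3,1,2)`, shift `2`, `v` fixed
    intro h2 h3
    have hw0 : (![3, 1, 2] : Fin 3 → ℕ) 0 = (![3, 1, 2] : Fin 3 → ℕ) 1 + 2 := by decide
    have h2' : σ (X 2) = X 2 := h2
    have h3' : σ (X 3) = X 3 + (X 2 ^ 2 + 2 * X 1 * X 2 + C (2 * c) * X 2 + C (1 - 3 * a) * X 1 ^ 2 - X 1 ^ 3 : MvPolynomial (Fin 4) k) := h3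
    have ht := QhAway.qhl_tail_mem (X 2 ^ 2 + 2 * X 1 * X 2 + C (2 * c) * X 2 + C (1 - 3 * a) * X 1 ^ 2 - X 1 ^ 3 : MvPolynomial (Fin 4) k)
      (![3, 1, 2] : Fin 3 → ℕ) 2 (Cusp.cuspTailQ_mem a c) hh
    have hσJ := QhAway.qhl_map_le σ hC h0 h1 h2' _ h3' (![3, 1, 2] : Fin 3 → ℕ) 2 hw0 (Cusp.cuspTailQ_mem a c) hh hσh
    exact ⟨ht, hσJ, QhAway.qhl_augmentationIdeal_sigmaR_le σ hC h0 h1 h2' _ h3' (![3, 1, 2] : Fin 3 → ℕ) 2 hw0 (Cusp.cuspTailQ_mem a c) hh hσh hp hσp hσJ,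
      QhAway.qhl_u'_zero_mem_residual σ h1 (![3, 1, 2] : Fin 3 → ℕ) 2 hw0 hh hσh hp hσp hσJ,
      QhAway.qhl_tail_mem_residual σ _ h3' (![3, 1, 2] : Fin 3 → ℕ) 2 hh hσh hp hσp hσJ ht⟩

end Summit.ResolutionOfSingularities.ResolutionOfSingularities.Theorems.WildQuotientResolution.S1.KillCert.Cusp

end
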